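import Literature.Probability.Percolation.TwoSetExchange
import Literature.Probability.Percolation.TripodExchange
import Summits.CriticalPhenomena.PercolationContinuityZ3.Theorems.PercNearOneGluingNoHeavyLowerTailFourPointAtoms

/-!
# Four-point exchange inequalities, types A and F2 (all `n`): the two remaining rows of the single-product atlas
# are instances of van den Berg–Häggström–Kahn's two-cluster / two-set exchange

Support file for crux `stmt-CriticalPhenomena-4575` (master-family programme, row `Q44`, single-source packing line),
seat `prim-l12-p6` gen 25.  Context: the ATLAS of all single-cell product inequalities `μ(p)μ(q) ≤ μ(p′)μ(q′)` between
four-point connectivity cells that are numerically valid (seat `prim-bnk-1` gen 33, memo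
`run/shared/lean/prim/prim-l12/FROM-prim-bnk-1-gen33-LAW-LEVEL-MONO-A.md` §4: 96 rows in 9 `S₄`-types; types B, D, E, F0, F1, G
proved there, `…FourPointExchangeB/D/EF/G`).  The two types left OPEN ("numerics only") in that memo are settled here, for every
finite weighted graph (`μ = prodBernoulli w` on a finite vertex type) and all marked points `a b c y`, in the cell numbering of
`FourPointAtoms.pat4`
(`0 a|b|c|y, 1 a|b|cy, 2 a|by|c, 3 a|bc|y, 4 ay|b|c, 5 ac|b|y, 6 ab|c|y, 7 a|bcy, 8 ay|bc, 9 ac|by, 10 acy|b, 11 ab|cy, 12 aby|c, 13 abc|y, 14 abcy`):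

* **Type A** (`typeA_cell`): `cell 0 · cell 11 ≤ cell 6 · cell 1`, i.e. `μ(a|b|c|y)·μ(ab|cy) ≤ μ(ab|c|y)·μ(a|b|cy)`.
  MEANING: conditionally on `{a,b} ↮ {c,y}` the events `{a ↔ b}` and `{c ↔ y}` are NEGATIVELY correlated.  This is the
  two-SET form of BHK 2006 Thm. 1.5 (= Thm. 2.1 at `q = 1`, tree `setTwoClusterExchange`) with `S = {a,b}`, `T = {c,y}`:
  `{a ↔ b}` is closed under enlarging `C_S` (type `(+)`), `{c ↔ y}` under enlarging `C_T` (type `(−)`).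
* **Type F2** (`typeF2_cell`, `typeF2'_cell`): `cell 11 · cell 9 ≤ cell 13 · cell 7` and `cell 11 · cell 9 ≤ cell 12 · cell 10`, i.e.
  `μ(ab|cy)·μ(ac|by) ≤ μ(abc|y)·μ(a|bcy)` and `≤ μ(aby|c)·μ(acy|b)` (the 6-row `S₄`-orbit consists of these two shapes for each of the
  three pairs of two-pair partitions).  These are LITERALLY the tripod exchange inequality (C⁺) of the tree
  (`tripodExchange`: `P(ox|yz)·P(oy|xz) ≤ P(oxz|y)·P(oyz|x)`) read at `(o,x,y,z) = (b,a,y,c)` and `(a,b,c,y)`.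

So every row of the atlas is now a theorem.  No named facts, no sorries, no definitions; proofs = the Literature exchange
theorems + the events ↦ cells dictionary (`FourPointAtoms.measureReal_eq_cellSum`).
-/

noncomputable section

namespace Summit.CriticalPhenomena.PercolationContinuityZ3.Theorems

namespace FourPointExchange

open MeasureTheory Set Literature.Probability.Percolation
open Literature.Probability.LatticeModels (prodBernoulli)
open FourPointAtoms
open Summit.CriticalPhenomena.PercolationContinuityZ3.Cruxes.AdditiveGluing.TieLine.ConnAtoms
open scoped Classical

variable {V : Type*}

/-- `{{a,b} ↮ {c,y}}` as an intersection of complements of connection events. [folklore] -/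
theorem Dis_pair_pair_eq (a b c y : V) :
    {ω : BondConfig V | ∀ s ∈ ({a, b} : Set V), ∀ t ∈ ({c, y} : Set V), ¬ (openGraph ω).Reachable s t} =
      ((openConn a c)ᶜ ∩ (openConn a y)ᶜ) ∩ ((openConn b c)ᶜ ∩ (openConn b y)ᶜ) := by
  ext ω
  simp only [Set.mem_setOf_eq, Set.mem_insert_iff, Set.mem_singleton_iff, forall_eq_or_imp, forall_eq,
    Set.mem_inter_iff, Set.mem_compl_iff, openConn]

variable [Fintype V] (w : Sym2 V → unitInterval) (a b c y : V)

/-! ## Type A: `μ(a|b|c|y) μ(ab|cy) ≤ μ(ab|c|y) μ(a|b|cy)` -/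

section dictA
/-! Dictionary for type A (`D = {a,b} ↮ {c,y} = (ac)ᶜ ∩ (ay)ᶜ ∩ (bc)ᶜ ∩ (by)ᶜ`). -/

/-- `μ(D) = cell 0 + cell 1 + cell 6 + cell 11`. [this work] -/
theorem realA_D : (prodBernoulli w).real (((openConn a c)ᶜ ∩ (openConn a y)ᶜ) ∩ ((openConn b c)ᶜ ∩ (openConn b y)ᶜ)) =
    cell w a b c y 0 + cell w a b c y 1 + cell w a b c y 6 + cell w a b c y 11 := by
  rw [measureReal_eq_cellSum w a b c y (show HasPattern (quad a b c y)
      (((openConn a c)ᶜ ∩ (openConn a y)ᶜ) ∩ ((openConn b c)ᶜ ∩ (openConn b y)ᶜ)) _ from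
    (((oc a b c y 0 2 rfl rfl).compl.inter (oc a b c y 0 3 rfl rfl).compl).inter
      ((oc a b c y 1 2 rfl rfl).compl.inter (oc a b c y 1 3 rfl rfl).compl)))]
  simp (config := {decide := true}) only [ite_true, ite_false]; ring

/-- `μ(D ∩ ({a↔b} ∩ {c↔y})) = cell 11`. [this work] -/
theorem realA_DFG : (prodBernoulli w).real ((((openConn a c)ᶜ ∩ (openConn a y)ᶜ) ∩ ((openConn b c)ᶜ ∩ (openConn b y)ᶜ)) ∩
      (openConn a b ∩ openConn c y)) = cell w a b c y 11 := by
  rw [measureReal_eq_cellSum w a b c y (show HasPattern (quad a b c y)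
      ((((openConn a c)ᶜ ∩ (openConn a y)ᶜ) ∩ ((openConn b c)ᶜ ∩ (openConn b y)ᶜ)) ∩ (openConn a b ∩ openConn c y)) _ from
    ((((oc a b c y 0 2 rfl rfl).compl.inter (oc a b c y 0 3 rfl rfl).compl).inter
      ((oc a b c y 1 2 rfl rfl).compl.inter (oc a b c y 1 3 rfl rfl).compl)).inter
      ((oc a b c y 0 1 rfl rfl).inter (oc a b c y 2 3 rfl rfl))))]
  simp (config := {decide := true}) only [ite_true, ite_false]; ring

/-- `μ(D ∩ {a↔b}) = cell 6 + cell 11`. [this work] -/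
theorem realA_DF : (prodBernoulli w).real ((((openConn a c)ᶜ ∩ (openConn a y)ᶜ) ∩ ((openConn b c)ᶜ ∩ (openConn b y)ᶜ)) ∩
      openConn a b) = cell w a b c y 6 + cell w a b c y 11 := by
  rw [measureReal_eq_cellSum w a b c y (show HasPattern (quad a b c y)
      ((((openConn a c)ᶜ ∩ (openConn a y)ᶜ) ∩ ((openConn b c)ᶜ ∩ (openConn b y)ᶜ)) ∩ openConn a b) _ from
    ((((oc a b c y 0 2 rfl rfl).compl.inter (oc a b c y 0 3 rfl rfl).compl).inter
      ((oc a b c y 1 2 rfl rfl).compl.inter (oc a b c y 1 3 rfl rfl).compl)).inter (oc a b c y 0 1 rfl rfl)))]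
  simp (config := {decide := true}) only [ite_true, ite_false]; ring

/-- `μ(D ∩ {c↔y}) = cell 1 + cell 11`. [this work] -/
theorem realA_DG : (prodBernoulli w).real ((((openConn a c)ᶜ ∩ (openConn a y)ᶜ) ∩ ((openConn b c)ᶜ ∩ (openConn b y)ᶜ)) ∩
      openConn c y) = cell w a b c y 1 + cell w a b c y 11 := by
  rw [measureReal_eq_cellSum w a b c y (show HasPattern (quad a b c y)
      ((((openConn a c)ᶜ ∩ (openConn a y)ᶜ) ∩ ((openConn b c)ᶜ ∩ (openConn b y)ᶜ)) ∩ openConn c y) _ from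
    ((((oc a b c y 0 2 rfl rfl).compl.inter (oc a b c y 0 3 rfl rfl).compl).inter
      ((oc a b c y 1 2 rfl rfl).compl.inter (oc a b c y 1 3 rfl rfl).compl)).inter (oc a b c y 2 3 rfl rfl)))]
  simp (config := {decide := true}) only [ite_true, ite_false]; ring

end dictA

/-- **Type A exchange inequality** (all `n`, all marked points): `μ(a|b|c|y) · μ(ab|cy) ≤ μ(ab|c|y) · μ(a|b|cy)`;
equivalently, given `{a,b} ↮ {c,y}` the events `{a ↔ b}` and `{c ↔ y}` are negatively correlated.  One application of the
two-set exchange `setTwoClusterExchange` (BHK 2006 Thm. 2.1 at `q = 1`) with `S = {a,b}`, `T = {c,y}`, `A₁ = {a↔b}`, `B₁ = {c↔y}`,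
`A₂ = B₂ = Ω`. [this work] -/
theorem typeA_cell : cell w a b c y 0 * cell w a b c y 11 ≤ cell w a b c y 6 * cell w a b c y 1 := by
  have ha : a ∈ ({a, b} : Set V) := by simp
  have hc : c ∈ ({c, y} : Set V) := by simp
  have key := setTwoClusterExchange w ({a, b} : Set V) ({c, y} : Set V)
    (A₁ := (openConn a b : Set (BondConfig V))) (A₂ := (Set.univ : Set (BondConfig V)))
    (B₁ := (openConn c y : Set (BondConfig V))) (B₂ := (Set.univ : Set (BondConfig V)))
    (TwoSetExchange.typePlus_openConn_of_mem ({a, b} : Set V) ({c, y} : Set V) ha b)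
    (fun _ _ _ _ _ => Set.mem_univ _)
    (TwoSetExchange.typeMinus_openConn_of_mem ({a, b} : Set V) ({c, y} : Set V) hc y)
    (fun _ _ _ _ _ => Set.mem_univ _)
  simp only [Set.inter_univ, Dis_pair_pair_eq] at key
  rw [realA_DFG, realA_D, realA_DF, realA_DG] at key
  nlinarith [key, cell_nonneg w a b c y 0, cell_nonneg w a b c y 1, cell_nonneg w a b c y 6, cell_nonneg w a b c y 11]

/-- Type A, conditional-covariance form: `μ(D ∩ {a↔b} ∩ {c↔y}) · μ(D) ≤ μ(D ∩ {a↔b}) · μ(D ∩ {c↔y})` with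
`D = {a,b} ↮ {c,y}` (in cells: `c₁₁ · (c₀+c₁+c₆+c₁₁) ≤ (c₆+c₁₁) · (c₁+c₁₁)`). [this work] -/
theorem typeA_negCorrelation :
    (prodBernoulli w).real ((((openConn a c)ᶜ ∩ (openConn a y)ᶜ) ∩ ((openConn b c)ᶜ ∩ (openConn b y)ᶜ)) ∩
        (openConn a b ∩ openConn c y)) *
      (prodBernoulli w).real (((openConn a c)ᶜ ∩ (openConn a y)ᶜ) ∩ ((openConn b c)ᶜ ∩ (openConn b y)ᶜ)) ≤
    (prodBernoulli w).real ((((openConn a c)ᶜ ∩ (openConn a y)ᶜ) ∩ ((openConn b c)ᶜ ∩ (openConn b y)ᶜ)) ∩ openConn a b) *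
      (prodBernoulli w).real ((((openConn a c)ᶜ ∩ (openConn a y)ᶜ) ∩ ((openConn b c)ᶜ ∩ (openConn b y)ᶜ)) ∩ openConn c y) := by
  rw [realA_DFG, realA_D, realA_DF, realA_DG]
  nlinarith [typeA_cell w a b c y, cell_nonneg w a b c y 0, cell_nonneg w a b c y 1, cell_nonneg w a b c y 6,
    cell_nonneg w a b c y 11]

/-! ## Type F2: `μ(ab|cy) μ(ac|by) ≤ μ(abc|y) μ(a|bcy)` and `≤ μ(aby|c) μ(acy|b)` -/

section dictF2
/-! Dictionary for type F2: the eight events of the two tripod exchanges as single cells. -/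

/-- `μ({b↔a} ∩ {y↔c} ∩ {a↮y}) = cell 11`. [this work] -/
theorem realF2_L₁ : (prodBernoulli w).real (openConn b a ∩ openConn y c ∩ (openConn a y)ᶜ) = cell w a b c y 11 := by
  rw [measureReal_eq_cellSum w a b c y (show HasPattern (quad a b c y) (openConn b a ∩ openConn y c ∩ (openConn a y)ᶜ) _ from
    (((oc a b c y 1 0 rfl rfl).inter (oc a b c y 3 2 rfl rfl)).inter (oc a b c y 0 3 rfl rfl).compl))]
  simp (config := {decide := true}) only [ite_true, ite_false]; ring

/-- `μ({b↔y} ∩ {a↔c} ∩ {a↮y}) = cell 9`. [this work] -/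
theorem realF2_L₂ : (prodBernoulli w).real (openConn b y ∩ openConn a c ∩ (openConn a y)ᶜ) = cell w a b c y 9 := by
  rw [measureReal_eq_cellSum w a b c y (show HasPattern (quad a b c y) (openConn b y ∩ openConn a c ∩ (openConn a y)ᶜ) _ from
    (((oc a b c y 1 3 rfl rfl).inter (oc a b c y 0 2 rfl rfl)).inter (oc a b c y 0 3 rfl rfl).compl))]
  simp (config := {decide := true}) only [ite_true, ite_false]; ring

/-- `μ({b↔a} ∩ {a↔c} ∩ {a↮y}) = cell 13`. [this work] -/
theorem realF2_R₁ : (prodBernoulli w).real (openConn b a ∩ openConn a c ∩ (openConn a y)ᶜ) = cell w a b c y 13 := by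
  rw [measureReal_eq_cellSum w a b c y (show HasPattern (quad a b c y) (openConn b a ∩ openConn a c ∩ (openConn a y)ᶜ) _ from
    (((oc a b c y 1 0 rfl rfl).inter (oc a b c y 0 2 rfl rfl)).inter (oc a b c y 0 3 rfl rfl).compl))]
  simp (config := {decide := true}) only [ite_true, ite_false]; ring

/-- `μ({b↔y} ∩ {y↔c} ∩ {a↮y}) = cell 7`. [this work] -/
theorem realF2_R₂ : (prodBernoulli w).real (openConn b y ∩ openConn y c ∩ (openConn a y)ᶜ) = cell w a b c y 7 := by
  rw [measureReal_eq_cellSum w a b c y (show HasPattern (quad a b c y) (openConn b y ∩ openConn y c ∩ (openConn a y)ᶜ) _ from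
    (((oc a b c y 1 3 rfl rfl).inter (oc a b c y 3 2 rfl rfl)).inter (oc a b c y 0 3 rfl rfl).compl))]
  simp (config := {decide := true}) only [ite_true, ite_false]; ring

/-- `μ({a↔b} ∩ {c↔y} ∩ {b↮c}) = cell 11`. [this work] -/
theorem realF2'_L₁ : (prodBernoulli w).real (openConn a b ∩ openConn c y ∩ (openConn b c)ᶜ) = cell w a b c y 11 := by
  rw [measureReal_eq_cellSum w a b c y (show HasPattern (quad a b c y) (openConn a b ∩ openConn c y ∩ (openConn b c)ᶜ) _ from
    (((oc a b c y 0 1 rfl rfl).inter (oc a b c y 2 3 rfl rfl)).inter (oc a b c y 1 2 rfl rfl).compl))]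
  simp (config := {decide := true}) only [ite_true, ite_false]; ring

/-- `μ({a↔c} ∩ {b↔y} ∩ {b↮c}) = cell 9`. [this work] -/
theorem realF2'_L₂ : (prodBernoulli w).real (openConn a c ∩ openConn b y ∩ (openConn b c)ᶜ) = cell w a b c y 9 := by
  rw [measureReal_eq_cellSum w a b c y (show HasPattern (quad a b c y) (openConn a c ∩ openConn b y ∩ (openConn b c)ᶜ) _ from
    (((oc a b c y 0 2 rfl rfl).inter (oc a b c y 1 3 rfl rfl)).inter (oc a b c y 1 2 rfl rfl).compl))]
  simp (config := {decide := true}) only [ite_true, ite_false]; ring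

/-- `μ({a↔b} ∩ {b↔y} ∩ {b↮c}) = cell 12`. [this work] -/
theorem realF2'_R₁ : (prodBernoulli w).real (openConn a b ∩ openConn b y ∩ (openConn b c)ᶜ) = cell w a b c y 12 := by
  rw [measureReal_eq_cellSum w a b c y (show HasPattern (quad a b c y) (openConn a b ∩ openConn b y ∩ (openConn b c)ᶜ) _ from
    (((oc a b c y 0 1 rfl rfl).inter (oc a b c y 1 3 rfl rfl)).inter (oc a b c y 1 2 rfl rfl).compl))]
  simp (config := {decide := true}) only [ite_true, ite_false]; ring

/-- `μ({a↔c} ∩ {c↔y} ∩ {b↮c}) = cell 10`. [this work] -/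
theorem realF2'_R₂ : (prodBernoulli w).real (openConn a c ∩ openConn c y ∩ (openConn b c)ᶜ) = cell w a b c y 10 := by
  rw [measureReal_eq_cellSum w a b c y (show HasPattern (quad a b c y) (openConn a c ∩ openConn c y ∩ (openConn b c)ᶜ) _ from
    (((oc a b c y 0 2 rfl rfl).inter (oc a b c y 2 3 rfl rfl)).inter (oc a b c y 1 2 rfl rfl).compl))]
  simp (config := {decide := true}) only [ite_true, ite_false]; ring

end dictF2

/-- **Type F2 exchange inequality** (all `n`): `μ(ab|cy) · μ(ac|by) ≤ μ(abc|y) · μ(a|bcy)` — the tripod exchange (C⁺)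
`tripodExchange w b a y c`. [this work] -/
theorem typeF2_cell : cell w a b c y 11 * cell w a b c y 9 ≤ cell w a b c y 13 * cell w a b c y 7 := by
  have key := tripodExchange w b a y c
  rwa [realF2_L₁, realF2_L₂, realF2_R₁, realF2_R₂] at key

/-- **Type F2 exchange inequality, second diagonal** (all `n`): `μ(ab|cy) · μ(ac|by) ≤ μ(aby|c) · μ(acy|b)` — the tripod exchange
(C⁺) `tripodExchange w a b c y`. [this work] -/
theorem typeF2'_cell : cell w a b c y 11 * cell w a b c y 9 ≤ cell w a b c y 12 * cell w a b c y 10 := by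
  have key := tripodExchange w a b c y
  rwa [realF2'_L₁, realF2'_L₂, realF2'_R₁, realF2'_R₂] at key

end FourPointExchange

end Summit.CriticalPhenomena.PercolationContinuityZ3.Theorems
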